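import Summits.BirchSwinnertonDyer.BirchSwinnertonDyer.Theorems.ManinLocalTwoThreeIndexFourFullTwoTorsion
import Summits.BirchSwinnertonDyer.Rank1Residual.ManinAdditive.KummerDiamondShapeLaws
import HarnessLib

/-!
# The LEGENDRE NORMAL FORM of a curve with full rational `2`-torsion, and the index-`4` world in that form:
# `C • W₀ = y² = x(x − A)(x − B)`, `A, B ∈ ℚˣ`, `A ≠ B` — the starting point of es's STEP 3 for THE curve `W₀` (no G1 transfer)
(route `ManinLocalTwoThree`, crux C2 `ManinOddAtFour` stmt-BirchSwinnertonDyer-22967; cell bsd-f2-manin, prover p2 gen 21; node for the Lean proof of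
E-es-185 `IndexFourForcesFreyTwistShape` (es g38 MEMO-es §59.5 STEP 3 / PROOF-Ees185-186.md §5–§6); `--supports stmt-BirchSwinnertonDyer-22967`)

es's row E-es-185 concludes `HasFreyTwistShape W₀ = ∃ s t C, Even s ∧ Odd t ∧ C • W₀ = freyTwistCurve s t` — a `VariableChange ℚ` statement about the
curve `W₀` of the datum itself.  Its paper proof (§59.13(a), "G1") transfers from the optimal quotient `E_opt` to `W₀` through the `c₄, c₆` dilation.  In the
kernel the transfer is unnecessary: p2 g21's `IndexFourTwoTorsion.indexFourForcesFullRationalTwoTorsion_of_cuspRational_CES` (p757495) gives THREE rational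
`2`-torsion abscissae of `W₀` directly, and this file turns three rational `2`-torsion abscissae of ANY Weierstrass curve over `ℚ` into the Legendre model:

* §1 a Greenberg `2`-torsion abscissa `x` (`2y + a₁x + a₃ = 0` on the curve) is a root of the `2`-division cubic `4x³ + b₂x² + 2b₄x + b₆` (tree:
  `Greenberg1999.fourXCubed_add_eq_zero_of_twoTorsion`); `b₂_b₄_b₆_of_three_roots` — Vieta for three DISTINCT roots: `b₂ = −4(x₁+x₂+x₃)`,
  `2b₄ = 4(x₁x₂+x₁x₃+x₂x₃)`, `b₆ = −4x₁x₂x₃` (finite differences, no polynomial library);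
* §2 **`exists_variableChange_eq_legendre`** — the change `(u,r,s,t) = (1, x₁, −a₁/2, −(a₃ + a₁x₁)/2)` carries `W` to `[0, −(A+B), 0, AB, 0]`,
  i.e. `y² = x(x − A)(x − B)` with `A = x₂ − x₁`, `B = x₃ − x₁` (both non-zero, `A ≠ B`);
* §3 **`exists_legendre_of_index_four`** — in the index-`4` configuration of a lattice-optimal `X₀(N)`-datum of a globally minimal `W₀` (`4 ∣ N`), modulo the
  printed facts F★ ∧ CES: `∃ A B C, A ≠ 0 ∧ B ≠ 0 ∧ A ≠ B ∧ C • W₀ = [0, −(A+B), 0, AB, 0]`; and the target reformulated: `hasFreyTwistShape_of_legendre` —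
  to prove `HasFreyTwistShape W₀` it suffices to reach `A = 2s²`, `B = t²` (`s` even, `t` odd) by a further `VariableChange` (dilation/permutation of roots),
  which is exactly es's number-theoretic STEP 3 (THEOREM K + 2-descent signs) — OPEN in Lean.

HONEST FRAMING.  §1–§2 unconditional algebra; §3 conditional on the statement-only printed facts F★ (`optimalGamma1Parametrization_cusp_rational`) and CES
(`exists_optimal_gamma1ParametrizationData`).  Nothing here proves E-es-185, C2, Manin's conjecture or BSD.  No definitions, no sorry.
[cite: SilvermanAEC2009, III.1 (variable changes, `b₂, b₄, b₆`) and X.1.4 (2-descent on the Legendre form)] [cite: GreenbergLNM1716, Prop. 5.14]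
[cite: ConradEdixhovenStein2003, §6.1.2 and §6.2] [cite: Stevens1989, §2]
-/

set_option autoImplicit false
-- lint-debt: the directory name repeats the summit name (sibling precedent `ManinLocalTwoThreeIndexFourFullTwoTorsion.lean`)
set_option linter.dupNamespace false

noncomputable section

open WeierstrassCurve Literature.NumberTheory.EllipticCurves Literature.NumberTheory.EllipticCurves.ModularForms
open Literature.NumberTheory.EllipticCurves.Greenberg1999
open Summit.BirchSwinnertonDyer.Rank1Residual.ManinAdditive.KummerDiamond

namespace Summit.BirchSwinnertonDyer.BirchSwinnertonDyer.Theorems.ManinLocalTwoThree.TwoTorsionNormalForm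

/-! ## §1 Vieta for three distinct roots of the `2`-division cubic -/

/-- **Vieta for three distinct roots of the `2`-division cubic**: `b₂ = −4Σxᵢ`, `2b₄ = 4Σxᵢxⱼ`, `b₆ = −4x₁x₂x₃` (finite differences). [folklore] -/
theorem b₂_b₄_b₆_of_three_roots {W : WeierstrassCurve ℚ} {x₁ x₂ x₃ : ℚ}
    (h₁ : 4 * x₁ ^ 3 + W.b₂ * x₁ ^ 2 + 2 * W.b₄ * x₁ + W.b₆ = 0)
    (h₂ : 4 * x₂ ^ 3 + W.b₂ * x₂ ^ 2 + 2 * W.b₄ * x₂ + W.b₆ = 0)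
    (h₃ : 4 * x₃ ^ 3 + W.b₂ * x₃ ^ 2 + 2 * W.b₄ * x₃ + W.b₆ = 0)
    (h12 : x₁ ≠ x₂) (h13 : x₁ ≠ x₃) (h23 : x₂ ≠ x₃) :
    W.b₂ = -4 * (x₁ + x₂ + x₃) ∧ 2 * W.b₄ = 4 * (x₁ * x₂ + x₁ * x₃ + x₂ * x₃) ∧ W.b₆ = -4 * (x₁ * x₂ * x₃) := by
  -- first differences
  have d12 : 4 * (x₁ ^ 2 + x₁ * x₂ + x₂ ^ 2) + W.b₂ * (x₁ + x₂) + 2 * W.b₄ = 0 := by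
    have e : (x₁ - x₂) * (4 * (x₁ ^ 2 + x₁ * x₂ + x₂ ^ 2) + W.b₂ * (x₁ + x₂) + 2 * W.b₄) = 0 := by
      linear_combination h₁ - h₂
    exact (mul_eq_zero.mp e).resolve_left (sub_ne_zero.mpr h12)
  have d13 : 4 * (x₁ ^ 2 + x₁ * x₃ + x₃ ^ 2) + W.b₂ * (x₁ + x₃) + 2 * W.b₄ = 0 := by
    have e : (x₁ - x₃) * (4 * (x₁ ^ 2 + x₁ * x₃ + x₃ ^ 2) + W.b₂ * (x₁ + x₃) + 2 * W.b₄) = 0 := by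
      linear_combination h₁ - h₃
    exact (mul_eq_zero.mp e).resolve_left (sub_ne_zero.mpr h13)
  -- second difference
  have hb₂ : W.b₂ = -4 * (x₁ + x₂ + x₃) := by
    have e : (x₂ - x₃) * (4 * (x₁ + x₂ + x₃) + W.b₂) = 0 := by linear_combination d12 - d13
    have := (mul_eq_zero.mp e).resolve_left (sub_ne_zero.mpr h23)
    linarith
  have hb₄ : 2 * W.b₄ = 4 * (x₁ * x₂ + x₁ * x₃ + x₂ * x₃) := by
    rw [hb₂] at d12; linear_combination d12
  refine ⟨hb₂, hb₄, ?_⟩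
  rw [hb₂] at h₁
  linear_combination h₁ - x₁ * hb₄

/-! ## §2 The Legendre model `y² = x(x − A)(x − B)` from three rational `2`-torsion abscissae -/

/-- **Legendre normal form from full rational `2`-torsion.**  If `x₁, x₂, x₃` are three pairwise distinct rational `2`-torsion abscissae of `W/ℚ`
(Greenberg's `HasRationalTwoTorsionX`), then the variable change `(u, r, s, t) = (1, x₁, −a₁/2, −(a₃ + a₁x₁)/2)` carries `W` to
`[0, −(A + B), 0, A·B, 0]`, i.e. `y² = x³ − (A+B)x² + ABx = x(x − A)(x − B)` with `A = x₂ − x₁ ≠ 0`, `B = x₃ − x₁ ≠ 0`, `A ≠ B`.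
[cite: SilvermanAEC2009, III.1 Table 3.1 and X.1.4] -/
theorem exists_variableChange_eq_legendre (W : WeierstrassCurve ℚ) {x₁ x₂ x₃ : ℚ} (h12 : x₁ ≠ x₂) (h13 : x₁ ≠ x₃) (h23 : x₂ ≠ x₃)
    (h₁ : HasRationalTwoTorsionX W x₁) (h₂ : HasRationalTwoTorsionX W x₂) (h₃ : HasRationalTwoTorsionX W x₃) :
    ∃ C : VariableChange ℚ, C • W = ⟨0, -((x₂ - x₁) + (x₃ - x₁)), 0, (x₂ - x₁) * (x₃ - x₁), 0⟩ := by
  obtain ⟨y₁, e₁, t₁⟩ := h₁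
  obtain ⟨y₂, e₂, t₂⟩ := h₂
  obtain ⟨y₃, e₃, t₃⟩ := h₃
  obtain ⟨hb₂, hb₄, hb₆⟩ := b₂_b₄_b₆_of_three_roots (fourXCubed_add_eq_zero_of_twoTorsion e₁ t₁)
    (fourXCubed_add_eq_zero_of_twoTorsion e₂ t₂) (fourXCubed_add_eq_zero_of_twoTorsion e₃ t₃) h12 h13 h23
  simp only [WeierstrassCurve.b₂, WeierstrassCurve.b₄, WeierstrassCurve.b₆] at hb₂ hb₄ hb₆
  refine ⟨⟨1, x₁, -W.a₁ / 2, -(W.a₃ + W.a₁ * x₁) / 2⟩, ?_⟩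
  ext
  · rw [variableChange_a₁]; simp; ring
  · rw [variableChange_a₂]; simp; linear_combination hb₂ / 4
  · rw [variableChange_a₃]; simp; ring
  · rw [variableChange_a₄]; simp; linear_combination hb₄ / 4 + x₁ * hb₂ / 2
  · rw [variableChange_a₆]; simp; linear_combination hb₆ / 4 + x₁ * hb₄ / 4 + x₁ ^ 2 * hb₂ / 4

/-- `HasFreyTwistShape` from a Legendre model with `A = 2s²`, `B = t²` (`s` even, `t` odd) — the form in which es's STEP 3 delivers the shape. [folklore] -/
theorem hasFreyTwistShape_of_legendre {W : WeierstrassCurve ℚ} {C : VariableChange ℚ} {s t : ℤ} (hs : Even s) (ht : Odd t)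
    (h : C • W = ⟨0, -((2 * (s : ℚ) ^ 2) + (t : ℚ) ^ 2), 0, (2 * (s : ℚ) ^ 2) * (t : ℚ) ^ 2, 0⟩) : HasFreyTwistShape W := by
  refine ⟨s, t, C, hs, ht, ?_⟩
  rw [h]
  ext <;> simp only [freyTwistCurve] <;> push_cast <;> ring

/-! ## §3 The index-`4` world in Legendre form (modulo F★ ∧ CES), for THE curve `W₀` -/

/-- **Index `4` ⟹ `W₀` itself has a Legendre model `y² = x(x − A)(x − B)` over `ℚ`** (`A, B ≠ 0`, `A ≠ B`), modulo the printed facts F★ ∧ CES: p2 g21's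
E-an-152d theorem (three distinct rational `2`-torsion abscissae of `W₀`) + §2.  This is es's STEP-3 starting point stated for `W₀` (no `E_opt`, no G1 transfer);
what remains for E-es-185 is to force `{A, B} = {2s², t²}` up to the admissible renormalisations (THEOREM K + the 2-descent signs).  CONDITIONAL on F★, CES.
[cite: ConradEdixhovenStein2003, §6.1.2, §6.2 and Lemma 6.1.6] [cite: Stevens1989, §2] [cite: SilvermanAEC2009, X.1.4] -/
theorem exists_legendre_of_index_four (hF : optimalGamma1Parametrization_cusp_rational) (hCES : exists_optimal_gamma1ParametrizationData)
    (W₀ : WeierstrassCurve ℚ) [W₀.IsElliptic] [W₀.IsGloballyMinimal] {N : ℕ} [NeZero N] (D₀ : ModularParametrizationData W₀ N)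
    (hopt : ∀ z ∈ D₀.L.lattice, ∃ w ∈ periodLattice D₀.f, z = D₀.c * w) (h4 : 2 ^ 2 ∣ N)
    (hidx : ∀ z : ℂ, z ∈ periodLatticeGamma1 D₀.f ↔ ∃ w ∈ periodLattice D₀.f, z = 2 * w) :
    ∃ (A B : ℚ) (C : VariableChange ℚ), A ≠ 0 ∧ B ≠ 0 ∧ A ≠ B ∧ C • W₀ = ⟨0, -(A + B), 0, A * B, 0⟩ := by
  obtain ⟨x₁, x₂, x₃, h12, h13, h23, h₁, h₂, h₃⟩ :=
    IndexFourTwoTorsion.indexFourForcesFullRationalTwoTorsion_of_cuspRational_CES hF hCES W₀ D₀ hopt h4 hidx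
  obtain ⟨C, hC⟩ := exists_variableChange_eq_legendre W₀ h12 h13 h23 h₁ h₂ h₃
  exact ⟨x₂ - x₁, x₃ - x₁, C, sub_ne_zero.mpr (Ne.symm h12), sub_ne_zero.mpr (Ne.symm h13),
    fun h ↦ h23 (by linarith), hC⟩

end Summit.BirchSwinnertonDyer.BirchSwinnertonDyer.Theorems.ManinLocalTwoThree.TwoTorsionNormalForm

end
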